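import Literature.Analysis.PDE.QuasilinearSymbol
import HarnessLib

/-!
# The linearisation of a quasilinear operator at a smooth map (topic `Analysis/PDE`)

Layer (III), step 1b (second part), of the programme to prove short-time existence for
quasilinear strictly parabolic systems on a closed manifold (hypothesis `hQL` of
`Literature.Geometry.Riemannian.ricciFlow_shortTime_existence_of_quasilinear`). The frozen
Picard scheme solves linear systems with the operator `L = DP(u₀)`, the linearisation of the
quasilinear operator `P` at the initial map `u₀`. This file defines `L` *globally*
(`linOp P u₀ v x = d/dε|₀ P(u₀ + ε v)(x)`, chart-free) and computes it in every framed chart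
`κ` in the frame form of the linear theory:

* `jetDom κ 𝒪` — the open jet domain `{(y, J) | y ∈ κ.target, (κ⁻¹ y, J.1) ∈ 𝒪}`;
* `baseJet`, `baseHess` — the `1`-jet `Z₀ = (û₀, Dû₀)` and the Hessian `H₀ = D²û₀` of
  `û₀ = u₀ ∘ κ⁻¹`;
* `linSymb`, `linFirst`, `linZero` — the coefficient fields `S, 𝔟, 𝔠` of the linearisation
  (`S` the symbol operator of `a z` at the base jet, `(𝔠, 𝔟)` the partial derivative of the
  chart nonlinearity in the jet at the base jet);
* `exists_forall_mem_of_isCompact` — the tube lemma: `u₀ + ε v` has graph in `𝒪` for small `ε`;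
* `linOp_inv_eq_frameOp` — **the chart representation of the linearisation**:
  `L v (κ⁻¹ y) = frameOp (S y) (𝔟 y) (𝔠 y) (v ∘ κ⁻¹) y` for smooth `v` and `y ∈ κ.target`.

Everything is proved; no named fact and no `sorry` is introduced.

## References

* C. Mantegazza, L. Martinazzi, *A note on quasilinear parabolic equations on manifolds*,
  Ann. Sc. Norm. Super. Pisa Cl. Sci. (5) 11 (2012), 857–874, §2 (linearisation).
  [MantegazzaMartinazzi2012]
* M. E. Taylor, *Partial Differential Equations III*, 2nd ed., Springer 2011, Ch. 15, §7.
  [TaylorPDEIII2011]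
-/

noncomputable section

open Set Function Filter Topology InnerProductSpace
open scoped Manifold ContDiff Topology RealInnerProductSpace

namespace Literature.Analysis.PDE

open Literature.Geometry.Manifold

variable {E : Type*} [NormedAddCommGroup E] [NormedSpace ℝ E] {H : Type*} [TopologicalSpace H]
variable {I : ModelWithCorners ℝ E H} {M : Type*} [TopologicalSpace M] [ChartedSpace H M]
variable {E' : Type*} [NormedAddCommGroup E'] [InnerProductSpace ℝ E'] [FiniteDimensional ℝ E']
variable {W : Type*} [NormedAddCommGroup W] [NormedSpace ℝ W]
variable {ι : Type*} [Fintype ι]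

/-! ### The global linearisation -/

/-- **The linearisation of `P` at `u₀`** (Gateaux derivative):
`L v x = d/dε|₀ P(u₀ + ε v)(x)`. [cite: MantegazzaMartinazzi2012, §2] -/
def linOp (P : (M → W) → M → W) (u₀ v : M → W) (x : M) : W :=
  deriv (fun ε : ℝ ↦ P (fun x' ↦ u₀ x' + ε • v x') x) 0

omit [TopologicalSpace M] [ChartedSpace H M] in
/-- `linOp_apply`: unfolding. [folklore] -/
theorem linOp_apply (P : (M → W) → M → W) (u₀ v : M → W) (x : M) :
    linOp P u₀ v x = deriv (fun ε : ℝ ↦ P (fun x' ↦ u₀ x' + ε • v x') x) 0 := rfl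

/-- **Tube lemma**: if `M` is compact, `𝒪 ⊆ M × W` is open, `u₀, v` are continuous and the
graph of `u₀` lies in `𝒪`, then the graph of `u₀ + ε v` lies in `𝒪` for all small `ε`.
[folklore] -/
theorem exists_forall_mem_of_isCompact [CompactSpace M] {𝒪 : Set (M × W)} (h𝒪 : IsOpen 𝒪) {u₀ v : M → W}
    (hu₀ : Continuous u₀) (hv : Continuous v) (hgraph : ∀ x, (x, u₀ x) ∈ 𝒪) :
    ∃ ε₀ : ℝ, 0 < ε₀ ∧ ∀ ε : ℝ, |ε| < ε₀ → ∀ x, (x, u₀ x + ε • v x) ∈ 𝒪 := by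
  -- the continuous map `(ε, x) ↦ (x, u₀ x + ε v x)` pulls `𝒪` back to an open set containing `{0} × M`
  set Φ : ℝ × M → M × W := fun q ↦ (q.2, u₀ q.2 + q.1 • v q.2) with hΦ
  have hΦc : Continuous Φ := continuous_snd.prodMk ((hu₀.comp continuous_snd).add ((continuous_fst).smul (hv.comp continuous_snd)))
  have hopen : IsOpen (Φ ⁻¹' 𝒪) := h𝒪.preimage hΦc
  have hsub : ({0} : Set ℝ) ×ˢ (univ : Set M) ⊆ Φ ⁻¹' 𝒪 := by
    rintro ⟨ε, x⟩ ⟨hε, -⟩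
    obtain rfl : ε = 0 := hε
    simpa [hΦ] using hgraph x
  obtain ⟨U, hU, h0U, hUV⟩ : ∃ U : Set ℝ, IsOpen U ∧ (0 : ℝ) ∈ U ∧ U ×ˢ (univ : Set M) ⊆ Φ ⁻¹' 𝒪 := by
    obtain ⟨U, V, hU, hV, h0, hMV, hUV⟩ := generalized_tube_lemma isCompact_singleton isCompact_univ hopen hsub
    exact ⟨U, hU, h0 rfl, fun q hq ↦ hUV ⟨hq.1, hMV hq.2⟩⟩
  obtain ⟨ε₀, hε₀, hball⟩ := Metric.isOpen_iff.1 hU 0 h0U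
  refine ⟨ε₀, hε₀, fun ε hε x ↦ ?_⟩
  have hεU : ε ∈ U := hball (by simpa [Real.dist_eq] using hε)
  have h := hUV (mk_mem_prod hεU (mem_univ x))
  simpa [hΦ] using h

/-! ### The jet domain and the base jet in a framed chart -/

variable (κ : FramedChart I M E') (b : Module.Basis ι ℝ E) (𝒪 : Set (M × W))
  (a : M → E × W × (E →L[ℝ] W) → ι → ι → ℝ) (f : M → E × W × (E →L[ℝ] W) → W) (u₀ : M → W)

/-- **The jet domain** of the framed chart: `{(y, J) | y ∈ κ.target, (κ⁻¹ y, J.1) ∈ 𝒪}`.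
[cite: MantegazzaMartinazzi2012, §2] -/
def jetDom : Set (E' × (W × (E' →L[ℝ] W))) := {q | q.1 ∈ κ.target ∧ (κ.inv q.1, q.2.1) ∈ 𝒪}

/-- The base `1`-jet `Z₀ = (û₀, Dû₀)`. [cite: MantegazzaMartinazzi2012, §2] -/
def baseJet (y : E') : W × (E' →L[ℝ] W) := (u₀ (κ.inv y), fderiv ℝ (u₀ ∘ κ.inv) y)

/-- The base Hessian `H₀ = D²û₀`. [cite: MantegazzaMartinazzi2012, §2] -/
def baseHess (y : E') : E' →L[ℝ] E' →L[ℝ] W := fderiv ℝ (fderiv ℝ (u₀ ∘ κ.inv)) y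

/-- The chart nonlinearity as a function of point and jet, at the base Hessian.
[cite: MantegazzaMartinazzi2012, §2] -/
def nonlinAtBase (q : E' × (W × (E' →L[ℝ] W))) : W := κ.chartNonlin b a f q.1 q.2.1 q.2.2 (baseHess κ u₀ q.1)

/-- **The symbol field of the linearisation**: the symbol operator of `a z` at the base jet.
[cite: MantegazzaMartinazzi2012, §2] -/
def linSymb (y : E') : E' →L[ℝ] E' := symbOp κ b fun i i' ↦ a κ.z (κ.jetBack y (baseJet κ u₀ y).1 (baseJet κ u₀ y).2) i i'

/-- The partial derivative of the chart nonlinearity in the jet at the base jet.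
[cite: MantegazzaMartinazzi2012, §2] -/
def linDZ (y : E') : (W × (E' →L[ℝ] W)) →L[ℝ] W :=
  fderiv ℝ (fun J : W × (E' →L[ℝ] W) ↦ κ.chartNonlin b a f y J.1 J.2 (baseHess κ u₀ y)) (baseJet κ u₀ y)

/-- **The zeroth-order field of the linearisation.** [cite: MantegazzaMartinazzi2012, §2] -/
def linZero (y : E') : W →L[ℝ] W := linDZ κ b a f u₀ y ∘L ContinuousLinearMap.inl ℝ W (E' →L[ℝ] W)

/-- **The first-order field of the linearisation.** [cite: MantegazzaMartinazzi2012, §2] -/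
def linFirst (y : E') : (E' →L[ℝ] W) →L[ℝ] W := linDZ κ b a f u₀ y ∘L ContinuousLinearMap.inr ℝ W (E' →L[ℝ] W)

variable {κ b 𝒪 a f u₀}

omit [FiniteDimensional ℝ E'] in
/-- The jet domain is open (boundaryless model, `𝒪` open). [folklore] -/
theorem isOpen_jetDom [I.Boundaryless] (h𝒪 : IsOpen 𝒪) : IsOpen (jetDom κ 𝒪 : Set (E' × (W × (E' →L[ℝ] W)))) := by
  have hc : ContinuousOn (fun q : E' × (W × (E' →L[ℝ] W)) ↦ (κ.inv q.1, q.2.1)) (κ.target ×ˢ univ) :=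
    (κ.continuousOn_inv.comp continuousOn_fst fun q hq ↦ (mem_prod.1 hq).1).prodMk (continuous_fst.comp continuous_snd).continuousOn
  have h := hc.isOpen_inter_preimage (κ.isOpen_target.prod isOpen_univ) h𝒪
  have heq : (jetDom κ 𝒪 : Set (E' × (W × (E' →L[ℝ] W)))) = κ.target ×ˢ univ ∩ (fun q : E' × (W × (E' →L[ℝ] W)) ↦ (κ.inv q.1, q.2.1)) ⁻¹' 𝒪 := by
    ext q; simp [jetDom]
  rw [heq]; exact h

omit [FiniteDimensional ℝ E'] in
/-- The pulled-back jet maps the jet domain into the extended-chart jet domain of `hQL`. [folklore] -/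
theorem jetBack_mem {y : E'} (hy : y ∈ κ.target) {w : W} (hw : (κ.inv y, w) ∈ 𝒪) (D : E' →L[ℝ] W) :
    κ.jetBack y w D ∈ {j : E × W × (E →L[ℝ] W) | j.1 ∈ (extChartAt I κ.z).target ∧ ((extChartAt I κ.z).symm j.1, j.2.1) ∈ 𝒪} := by
  refine ⟨(κ.mem_target_iff y).1 hy, ?_⟩
  simp only [FramedChart.jetBack_apply]
  rwa [← κ.inv_apply]

omit [Fintype ι] [FiniteDimensional ℝ E'] in
/-- **Smoothness of the coefficients in framed-chart jet variables**: with `a z` smooth on the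
extended-chart jet domain, `(y, J) ↦ a z (jetBack y J) i i'` is smooth on the jet domain.
[cite: MantegazzaMartinazzi2012, §2] -/
theorem contDiffOn_coeff_jetBack
    (ha : ∀ i i', ContDiffOn ℝ ∞ (fun j ↦ a κ.z j i i') {j | j.1 ∈ (extChartAt I κ.z).target ∧ ((extChartAt I κ.z).symm j.1, j.2.1) ∈ 𝒪})
    (i i' : ι) :
    ContDiffOn ℝ ∞ (fun q : E' × (W × (E' →L[ℝ] W)) ↦ a κ.z (κ.jetBack q.1 q.2.1 q.2.2) i i') (jetDom κ 𝒪) := by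
  have hjb : ContDiff ℝ ∞ fun q : E' × (W × (E' →L[ℝ] W)) ↦ κ.jetBack q.1 q.2.1 q.2.2 := by
    refine ((κ.A.symm : E' →L[ℝ] E).contDiff.comp (contDiff_fst.sub contDiff_const)).prodMk
      ((contDiff_fst.comp contDiff_snd).prodMk ?_)
    exact ((ContinuousLinearMap.compL ℝ E E' W).flip (κ.A : E →L[ℝ] E')).contDiff.comp (contDiff_snd.comp contDiff_snd)
  exact (ha i i').comp hjb.contDiffOn fun q hq ↦ jetBack_mem hq.1 hq.2 _

omit [Fintype ι] [FiniteDimensional ℝ E'] in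
/-- The same for the inhomogeneity `f z`. [cite: MantegazzaMartinazzi2012, §2] -/
theorem contDiffOn_inhom_jetBack
    (hf : ContDiffOn ℝ ∞ (f κ.z) {j | j.1 ∈ (extChartAt I κ.z).target ∧ ((extChartAt I κ.z).symm j.1, j.2.1) ∈ 𝒪}) :
    ContDiffOn ℝ ∞ (fun q : E' × (W × (E' →L[ℝ] W)) ↦ f κ.z (κ.jetBack q.1 q.2.1 q.2.2)) (jetDom κ 𝒪) := by
  have hjb : ContDiff ℝ ∞ fun q : E' × (W × (E' →L[ℝ] W)) ↦ κ.jetBack q.1 q.2.1 q.2.2 := by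
    refine ((κ.A.symm : E' →L[ℝ] E).contDiff.comp (contDiff_fst.sub contDiff_const)).prodMk
      ((contDiff_fst.comp contDiff_snd).prodMk ?_)
    exact ((ContinuousLinearMap.compL ℝ E E' W).flip (κ.A : E →L[ℝ] E')).contDiff.comp (contDiff_snd.comp contDiff_snd)
  exact hf.comp hjb.contDiffOn fun q hq ↦ jetBack_mem hq.1 hq.2 _

omit [FiniteDimensional ℝ E'] in
/-- **Smoothness of the chart nonlinearity at a smooth Hessian field**: for `h : E' → _` smooth
on the target, `(y, J) ↦ chartNonlin y J.1 J.2 (h y)` is smooth on the jet domain.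
[cite: MantegazzaMartinazzi2012, §2] -/
theorem contDiffOn_chartNonlin
    (ha : ∀ i i', ContDiffOn ℝ ∞ (fun j ↦ a κ.z j i i') {j | j.1 ∈ (extChartAt I κ.z).target ∧ ((extChartAt I κ.z).symm j.1, j.2.1) ∈ 𝒪})
    (hf : ContDiffOn ℝ ∞ (f κ.z) {j | j.1 ∈ (extChartAt I κ.z).target ∧ ((extChartAt I κ.z).symm j.1, j.2.1) ∈ 𝒪})
    {h : E' → E' →L[ℝ] E' →L[ℝ] W} (hh : ContDiffOn ℝ ∞ h κ.target) :
    ContDiffOn ℝ ∞ (fun q : E' × (W × (E' →L[ℝ] W)) ↦ κ.chartNonlin b a f q.1 q.2.1 q.2.2 (h q.1)) (jetDom κ 𝒪) := by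
  have hh' : ContDiffOn ℝ ∞ (fun q : E' × (W × (E' →L[ℝ] W)) ↦ h q.1) (jetDom κ 𝒪) := hh.comp contDiffOn_fst fun q hq ↦ hq.1
  have hterm : ∀ i i', ContDiffOn ℝ ∞ (fun q : E' × (W × (E' →L[ℝ] W)) ↦ a κ.z (κ.jetBack q.1 q.2.1 q.2.2) i i' • h q.1 (κ.A (b i)) (κ.A (b i')))
      (jetDom κ 𝒪) := fun i i' ↦ (contDiffOn_coeff_jetBack ha i i').smul ((hh'.clm_apply contDiffOn_const).clm_apply contDiffOn_const)
  have heq : (fun q : E' × (W × (E' →L[ℝ] W)) ↦ κ.chartNonlin b a f q.1 q.2.1 q.2.2 (h q.1)) = fun q ↦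
      (∑ i, ∑ i', a κ.z (κ.jetBack q.1 q.2.1 q.2.2) i i' • h q.1 (κ.A (b i)) (κ.A (b i'))) + f κ.z (κ.jetBack q.1 q.2.1 q.2.2) := by
    funext q; rw [FramedChart.chartNonlin_apply]
  rw [heq]
  exact (ContDiffOn.sum fun i _ ↦ ContDiffOn.sum fun i' _ ↦ hterm i i').add (contDiffOn_inhom_jetBack hf)

/-! ### The chart representation of the linearisation -/

/-- **The chart representation of the linearisation.** Let `M` be compact, `𝒪` open, the
coefficients `a z, f z` smooth on the extended-chart jet domain and `P` represented in the
extended chart at `z` on smooth maps with graph in `𝒪` (the hypotheses of `hQL` at the base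
point `z` of the framed chart `κ`). Then for smooth `u₀` with graph in `𝒪`, smooth `v` and
`y ∈ κ.target`:
`linOp P u₀ v (κ⁻¹ y) = frameOp (linSymb y) (linFirst y) (linZero y) (v ∘ κ⁻¹) y`.
[cite: MantegazzaMartinazzi2012, §2] -/
theorem linOp_inv_eq_frameOp [CompactSpace M] [I.Boundaryless] [IsManifold I ∞ M] {P : (M → W) → M → W} (h𝒪 : IsOpen 𝒪)
    (ha : ∀ i i', ContDiffOn ℝ ∞ (fun j ↦ a κ.z j i i') {j | j.1 ∈ (extChartAt I κ.z).target ∧ ((extChartAt I κ.z).symm j.1, j.2.1) ∈ 𝒪})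
    (hf : ContDiffOn ℝ ∞ (f κ.z) {j | j.1 ∈ (extChartAt I κ.z).target ∧ ((extChartAt I κ.z).symm j.1, j.2.1) ∈ 𝒪})
    (hP : ∀ u : M → W, ContMDiff I 𝓘(ℝ, W) ∞ u → (∀ x, (x, u x) ∈ 𝒪) → ∀ η ∈ (extChartAt I κ.z).target,
      P u ((extChartAt I κ.z).symm η) =
        (∑ i, ∑ i', a κ.z (η, u ((extChartAt I κ.z).symm η), fderiv ℝ (u ∘ (extChartAt I κ.z).symm) η) i i' •
          fderiv ℝ (fderiv ℝ (u ∘ (extChartAt I κ.z).symm)) η (b i) (b i')) +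
        f κ.z (η, u ((extChartAt I κ.z).symm η), fderiv ℝ (u ∘ (extChartAt I κ.z).symm) η))
    (hu₀ : ContMDiff I 𝓘(ℝ, W) ∞ u₀) (hg₀ : ∀ x, (x, u₀ x) ∈ 𝒪) {v : M → W} (hv : ContMDiff I 𝓘(ℝ, W) ∞ v) {y : E'} (hy : y ∈ κ.target) :
    linOp P u₀ v (κ.inv y) = frameOp (linSymb κ b a u₀ y) (linFirst κ b a f u₀ y) (linZero κ b a f u₀ y) (v ∘ κ.inv) y := by
  -- chart expressions
  have huh : ContDiffOn ℝ ∞ (u₀ ∘ κ.inv) κ.target := κ.contDiffOn_comp_inv hu₀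
  have hvh : ContDiffOn ℝ ∞ (v ∘ κ.inv) κ.target := κ.contDiffOn_comp_inv hv
  have hT := κ.isOpen_target
  have hyn : κ.target ∈ 𝓝 y := hT.mem_nhds hy
  have hdu : DifferentiableAt ℝ (u₀ ∘ κ.inv) y := (huh.differentiableOn (by simp)).differentiableAt hyn
  have hdv : DifferentiableAt ℝ (v ∘ κ.inv) y := (hvh.differentiableOn (by simp)).differentiableAt hyn
  have hDu : ContDiffOn ℝ ∞ (fderiv ℝ (u₀ ∘ κ.inv)) κ.target := huh.fderiv_of_isOpen hT (by norm_cast)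
  have hDv : ContDiffOn ℝ ∞ (fderiv ℝ (v ∘ κ.inv)) κ.target := hvh.fderiv_of_isOpen hT (by norm_cast)
  have hdDu : DifferentiableAt ℝ (fderiv ℝ (u₀ ∘ κ.inv)) y := (hDu.differentiableOn (by simp)).differentiableAt hyn
  have hdDv : DifferentiableAt ℝ (fderiv ℝ (v ∘ κ.inv)) y := (hDv.differentiableOn (by simp)).differentiableAt hyn
  -- the tube
  obtain ⟨ε₀, hε₀, htube⟩ := exists_forall_mem_of_isCompact h𝒪 hu₀.continuous hv.continuous hg₀
  -- abbreviations
  set Z₀ : W × (E' →L[ℝ] W) := baseJet κ u₀ y with hZ₀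
  set 𝔷 : W × (E' →L[ℝ] W) := ((v ∘ κ.inv) y, fderiv ℝ (v ∘ κ.inv) y) with h𝔷
  set H₀ := baseHess κ u₀ y with hH₀
  set Ĥ := fderiv ℝ (fderiv ℝ (v ∘ κ.inv)) y with hĤ
  set Aterm : ℝ → W := fun ε ↦ ∑ i, ∑ i', a κ.z (κ.jetBack y (Z₀.1 + ε • 𝔷.1) (Z₀.2 + ε • 𝔷.2)) i i' • Ĥ (κ.A (b i)) (κ.A (b i')) with hA
  set N₁ : W × (E' →L[ℝ] W) → W := fun J ↦ κ.chartNonlin b a f y J.1 J.2 H₀ with hN₁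
  -- Step 1: for small `ε`, the representation of `P (u₀ + ε v)` in the framed chart
  have hrep : ∀ᶠ ε in 𝓝 (0 : ℝ), P (fun x' ↦ u₀ x' + ε • v x') (κ.inv y) = N₁ (Z₀ + ε • 𝔷) + ε • Aterm ε := by
    have hball : Metric.ball (0 : ℝ) ε₀ ∈ 𝓝 (0 : ℝ) := Metric.ball_mem_nhds 0 hε₀
    filter_upwards [hball] with ε hε
    have hε' : |ε| < ε₀ := by simpa [Real.dist_eq] using hε
    set uε : M → W := fun x' ↦ u₀ x' + ε • v x' with huε
    have hsm : ContMDiff I 𝓘(ℝ, W) ∞ fun x' ↦ ε • v x' := ((ε • ContinuousLinearMap.id ℝ W).contMDiff).comp hv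
    have huεs : ContMDiff I 𝓘(ℝ, W) ∞ uε := hu₀.add hsm
    have hgε : ∀ x, (x, uε x) ∈ 𝒪 := htube ε hε'
    have hûε : ContDiffOn ℝ ∞ (uε ∘ κ.inv) κ.target := κ.contDiffOn_comp_inv huεs
    have h1 := κ.apply_inv_eq_chartNonlin b (hP uε huεs hgε) hT (hûε.of_le (by norm_cast)) hy hy
    rw [h1]
    -- the jet of `uε` at `y`
    have hfun : uε ∘ κ.inv = fun y' ↦ (u₀ ∘ κ.inv) y' + ε • (v ∘ κ.inv) y' := rfl
    have hval : uε (κ.inv y) = Z₀.1 + ε • 𝔷.1 := rfl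
    have hD : fderiv ℝ (uε ∘ κ.inv) y = Z₀.2 + ε • 𝔷.2 := by
      have hdv2 : DifferentiableAt ℝ (fun y' ↦ ε • (v ∘ κ.inv) y') y := hdv.const_smul ε
      rw [hfun, fderiv_fun_add hdu hdv2, fderiv_fun_const_smul hdv]
      rfl
    have hDD : fderiv ℝ (fderiv ℝ (uε ∘ κ.inv)) y = H₀ + ε • Ĥ := by
      have hev : fderiv ℝ (uε ∘ κ.inv) =ᶠ[𝓝 y] fun y' ↦ fderiv ℝ (u₀ ∘ κ.inv) y' + ε • fderiv ℝ (v ∘ κ.inv) y' := by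
        filter_upwards [hyn] with y' hy'
        have hdu' : DifferentiableAt ℝ (u₀ ∘ κ.inv) y' := (huh.differentiableOn (by simp)).differentiableAt (hT.mem_nhds hy')
        have hdv' : DifferentiableAt ℝ (v ∘ κ.inv) y' := (hvh.differentiableOn (by simp)).differentiableAt (hT.mem_nhds hy')
        have hdv2 : DifferentiableAt ℝ (fun y' ↦ ε • (v ∘ κ.inv) y') y' := hdv'.const_smul ε
        rw [hfun, fderiv_fun_add hdu' hdv2, fderiv_fun_const_smul hdv']
      have hdDv2 : DifferentiableAt ℝ (fun y' ↦ ε • fderiv ℝ (v ∘ κ.inv) y') y := hdDv.const_smul ε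
      rw [hev.fderiv_eq, fderiv_fun_add hdDu hdDv2, fderiv_fun_const_smul hdDv]
      rfl
    rw [hval, hD, hDD, FramedChart.chartNonlin_apply, hN₁, hA]
    simp only [FramedChart.chartNonlin_apply, Prod.fst_add, Prod.snd_add, Prod.smul_fst, Prod.smul_snd, FunLike.coe_add, Pi.add_apply,
      FunLike.coe_smul, Pi.smul_apply, smul_add, Finset.sum_add_distrib, Finset.smul_sum]
    have hcomm : ∀ i i', a κ.z (κ.jetBack y (Z₀.1 + ε • 𝔷.1) (Z₀.2 + ε • 𝔷.2)) i i' • ε • Ĥ (κ.A (b i)) (κ.A (b i')) =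
        ε • a κ.z (κ.jetBack y (Z₀.1 + ε • 𝔷.1) (Z₀.2 + ε • 𝔷.2)) i i' • Ĥ (κ.A (b i)) (κ.A (b i')) := fun i i' ↦ smul_comm _ _ _
    simp only [hcomm]
    abel
  -- Step 2: the derivative of the right-hand side at `ε = 0`
  have hmem : ((y, Z₀) : E' × (W × (E' →L[ℝ] W))) ∈ jetDom κ 𝒪 := ⟨hy, by simpa [hZ₀, baseJet] using hg₀ (κ.inv y)⟩
  have hDom := isOpen_jetDom (κ := κ) (W := W) h𝒪
  have hline : HasDerivAt (fun ε : ℝ ↦ Z₀ + ε • 𝔷) 𝔷 0 := by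
    simpa using ((hasDerivAt_id (0 : ℝ)).smul_const 𝔷).const_add Z₀
  have hN₁d : DifferentiableAt ℝ N₁ Z₀ := by
    have hjoint := contDiffOn_chartNonlin (κ := κ) (b := b) ha hf ((huh.fderiv_of_isOpen (m := ∞) hT (by norm_cast)).fderiv_of_isOpen (m := ∞) hT (by norm_cast))
    have hat : ContDiffAt ℝ ∞ (fun q : E' × (W × (E' →L[ℝ] W)) ↦ κ.chartNonlin b a f q.1 q.2.1 q.2.2 (baseHess κ u₀ q.1)) (y, Z₀) :=
      hjoint.contDiffAt (hDom.mem_nhds hmem)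
    have hcomp : ContDiffAt ℝ ∞ N₁ Z₀ := hat.comp Z₀ (contDiffAt_const.prodMk contDiffAt_id)
    exact hcomp.differentiableAt (by simp)
  have h1 : HasDerivAt (fun ε : ℝ ↦ N₁ (Z₀ + ε • 𝔷)) (linDZ κ b a f u₀ y 𝔷) 0 := by
    have h := hN₁d.hasFDerivAt
    have h0 : (fun ε : ℝ ↦ Z₀ + ε • 𝔷) 0 = Z₀ := by simp
    rw [← h0] at h
    have hc := h.comp_hasDerivAt (0 : ℝ) hline
    rw [h0] at hc
    exact hc
  have hAd : DifferentiableAt ℝ Aterm 0 := by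
    have hcoef : ∀ i i', DifferentiableAt ℝ (fun ε : ℝ ↦ a κ.z (κ.jetBack y (Z₀.1 + ε • 𝔷.1) (Z₀.2 + ε • 𝔷.2)) i i') 0 := by
      intro i i'
      have hat : ContDiffAt ℝ ∞ (fun q : E' × (W × (E' →L[ℝ] W)) ↦ a κ.z (κ.jetBack q.1 q.2.1 q.2.2) i i') (y, Z₀) :=
        (contDiffOn_coeff_jetBack ha i i').contDiffAt (hDom.mem_nhds hmem)
      have hpath : ContDiff ℝ ∞ fun ε : ℝ ↦ ((y, Z₀ + ε • 𝔷) : E' × (W × (E' →L[ℝ] W))) :=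
        contDiff_const.prodMk (contDiff_const.add (contDiff_id.smul contDiff_const))
      have h0 : (fun ε : ℝ ↦ ((y, Z₀ + ε • 𝔷) : E' × (W × (E' →L[ℝ] W)))) 0 = (y, Z₀) := by simp
      rw [← h0] at hat
      have hc := hat.comp (0 : ℝ) hpath.contDiffAt
      exact hc.differentiableAt (by simp)
    simp only [hA]
    exact DifferentiableAt.fun_sum fun i _ ↦ DifferentiableAt.fun_sum fun i' _ ↦ (hcoef i i').smul_const _
  have h2 : HasDerivAt (fun ε : ℝ ↦ ε • Aterm ε) (Aterm 0) 0 := by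
    have h := (hasDerivAt_id (0 : ℝ)).smul hAd.hasDerivAt
    simp only [id_eq, zero_smul, one_smul, zero_add] at h
    exact h
  have hderiv : HasDerivAt (fun ε : ℝ ↦ P (fun x' ↦ u₀ x' + ε • v x') (κ.inv y)) (linDZ κ b a f u₀ y 𝔷 + Aterm 0) 0 :=
    (h1.add h2).congr_of_eventuallyEq hrep
  -- Step 3: identify with the frame operator
  rw [linOp_apply, hderiv.deriv, frameOp_apply, linSymb, principalPart_symbOp κ b _ hT hy (hvh.of_le (by norm_cast))]
  have hsplit : linDZ κ b a f u₀ y 𝔷 = linFirst κ b a f u₀ y (fderiv ℝ (v ∘ κ.inv) y) + linZero κ b a f u₀ y ((v ∘ κ.inv) y) := by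
    simp only [linFirst, linZero, ContinuousLinearMap.coe_comp, Function.comp_apply, ContinuousLinearMap.inl_apply,
      ContinuousLinearMap.inr_apply, ← map_add, Prod.mk_add_mk, zero_add, h𝔷, add_comm]
  rw [hsplit, hA]
  simp only [zero_smul, add_zero]
  have hjb : κ.jetBack y Z₀.1 Z₀.2 = κ.jetBack y (baseJet κ u₀ y).1 (baseJet κ u₀ y).2 := rfl
  rw [hjb]
  abel


/-! ### Smoothness of the coefficient fields of the linearisation -/

section CoeffSmooth

variable [I.Boundaryless]
  (ha : ∀ i i', ContDiffOn ℝ ∞ (fun j ↦ a κ.z j i i') {j | j.1 ∈ (extChartAt I κ.z).target ∧ ((extChartAt I κ.z).symm j.1, j.2.1) ∈ 𝒪})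
  (hf : ContDiffOn ℝ ∞ (f κ.z) {j | j.1 ∈ (extChartAt I κ.z).target ∧ ((extChartAt I κ.z).symm j.1, j.2.1) ∈ 𝒪})
  (h𝒪 : IsOpen 𝒪) (huh : ContDiffOn ℝ ∞ (u₀ ∘ κ.inv) κ.target) (hg : ∀ y ∈ κ.target, (κ.inv y, u₀ (κ.inv y)) ∈ 𝒪)

include huh in
omit [FiniteDimensional ℝ E'] in
/-- The base jet is smooth on the target. [folklore] -/
theorem contDiffOn_baseJet : ContDiffOn ℝ ∞ (baseJet κ u₀) κ.target :=
  huh.prodMk (huh.fderiv_of_isOpen κ.isOpen_target (by norm_cast))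

include huh in
omit [FiniteDimensional ℝ E'] in
/-- The base Hessian is smooth on the target. [folklore] -/
theorem contDiffOn_baseHess : ContDiffOn ℝ ∞ (baseHess κ u₀) κ.target :=
  (huh.fderiv_of_isOpen (m := ∞) κ.isOpen_target (by norm_cast)).fderiv_of_isOpen κ.isOpen_target (by norm_cast)

include hg in
omit [FiniteDimensional ℝ E'] [I.Boundaryless] in
/-- The graph of the base jet lies in the jet domain. [folklore] -/
theorem mk_baseJet_mem_jetDom {y : E'} (hy : y ∈ κ.target) : ((y, baseJet κ u₀ y) : E' × (W × (E' →L[ℝ] W))) ∈ jetDom κ 𝒪 :=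
  ⟨hy, hg y hy⟩

include ha huh hg in
omit [FiniteDimensional ℝ E'] in
/-- **The symbol field of the linearisation is smooth on the target.** [cite: MantegazzaMartinazzi2012, §2] -/
theorem contDiffOn_linSymb : ContDiffOn ℝ ∞ (linSymb κ b a u₀) κ.target := by
  have hpath : ContDiffOn ℝ ∞ (fun y ↦ ((y, baseJet κ u₀ y) : E' × (W × (E' →L[ℝ] W)))) κ.target := contDiffOn_id.prodMk (contDiffOn_baseJet huh)
  have hcoef : ∀ i i', ContDiffOn ℝ ∞ (fun y ↦ a κ.z (κ.jetBack y (baseJet κ u₀ y).1 (baseJet κ u₀ y).2) i i') κ.target := fun i i' ↦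
    (contDiffOn_coeff_jetBack ha i i').comp hpath fun y hy ↦ mk_baseJet_mem_jetDom hg hy
  have heq : linSymb κ b a u₀ = fun y ↦ ∑ i, ∑ i', a κ.z (κ.jetBack y (baseJet κ u₀ y).1 (baseJet κ u₀ y).2) i i' •
      (innerSL ℝ (κ.A (b i'))).smulRight (κ.A (b i)) := by
    funext y; rfl
  rw [heq]
  exact ContDiffOn.sum fun i _ ↦ ContDiffOn.sum fun i' _ ↦ (hcoef i i').smul contDiffOn_const

include ha hf h𝒪 huh hg in
omit [FiniteDimensional ℝ E'] in
/-- **The jet-derivative field of the linearisation is smooth on the target.**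
[cite: MantegazzaMartinazzi2012, §2] -/
theorem contDiffOn_linDZ : ContDiffOn ℝ ∞ (linDZ κ b a f u₀) κ.target := by
  set Ñ : E' × (W × (E' →L[ℝ] W)) → W := fun q ↦ κ.chartNonlin b a f q.1 q.2.1 q.2.2 (baseHess κ u₀ q.1) with hÑ
  have hÑs : ContDiffOn ℝ ∞ Ñ (jetDom κ 𝒪) := contDiffOn_chartNonlin ha hf (contDiffOn_baseHess huh)
  have hDom := isOpen_jetDom (κ := κ) (W := W) h𝒪
  have hDÑ : ContDiffOn ℝ ∞ (fderiv ℝ Ñ) (jetDom κ 𝒪) := hÑs.fderiv_of_isOpen hDom (by norm_cast)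
  have hpath : ContDiffOn ℝ ∞ (fun y ↦ ((y, baseJet κ u₀ y) : E' × (W × (E' →L[ℝ] W)))) κ.target := contDiffOn_id.prodMk (contDiffOn_baseJet huh)
  -- the partial derivative through the full derivative
  have heq : ∀ y ∈ κ.target, linDZ κ b a f u₀ y = fderiv ℝ Ñ (y, baseJet κ u₀ y) ∘L ContinuousLinearMap.inr ℝ E' (W × (E' →L[ℝ] W)) := by
    intro y hy
    have hd : DifferentiableAt ℝ Ñ (y, baseJet κ u₀ y) := (hÑs.differentiableOn (by simp)).differentiableAt (hDom.mem_nhds (mk_baseJet_mem_jetDom hg hy))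
    have h1 : HasFDerivAt (fun J : W × (E' →L[ℝ] W) ↦ ((y, J) : E' × (W × (E' →L[ℝ] W)))) (ContinuousLinearMap.inr ℝ E' _) (baseJet κ u₀ y) :=
      (hasFDerivAt_const y _).prodMk (hasFDerivAt_id _)
    have h2 := hd.hasFDerivAt.comp _ h1
    exact h2.fderiv
  refine ContDiffOn.congr ?_ heq
  exact (hDÑ.comp hpath fun y hy ↦ mk_baseJet_mem_jetDom hg hy).clm_comp contDiffOn_const

include ha hf h𝒪 huh hg in
omit [FiniteDimensional ℝ E'] in
/-- The zeroth-order field of the linearisation is smooth on the target. [cite: MantegazzaMartinazzi2012, §2] -/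
theorem contDiffOn_linZero : ContDiffOn ℝ ∞ (linZero κ b a f u₀) κ.target :=
  (contDiffOn_linDZ ha hf h𝒪 huh hg).clm_comp contDiffOn_const

include ha hf h𝒪 huh hg in
omit [FiniteDimensional ℝ E'] in
/-- The first-order field of the linearisation is smooth on the target. [cite: MantegazzaMartinazzi2012, §2] -/
theorem contDiffOn_linFirst : ContDiffOn ℝ ∞ (linFirst κ b a f u₀) κ.target :=
  (contDiffOn_linDZ ha hf h𝒪 huh hg).clm_comp contDiffOn_const

end CoeffSmooth

/-! ### Symmetry and positivity of the symbol field -/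

/-- **The symbol field is self-adjoint and positive** when the coefficients are symmetric and
positive definite on the jet domain (the structure hypothesis of `hQL` at `z`).
[cite: MantegazzaMartinazzi2012, §2] -/
theorem adjoint_linSymb_and_pos
    (hstruct : ∀ j : E × W × (E →L[ℝ] W), j.1 ∈ (extChartAt I κ.z).target → ((extChartAt I κ.z).symm j.1, j.2.1) ∈ 𝒪 →
      (∀ i i', a κ.z j i i' = a κ.z j i' i) ∧ ∀ ξ : ι → ℝ, ξ ≠ 0 → 0 < ∑ i, ∑ i', a κ.z j i i' * ξ i * ξ i')
    (hg : ∀ y ∈ κ.target, (κ.inv y, u₀ (κ.inv y)) ∈ 𝒪) {y : E'} (hy : y ∈ κ.target) :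
    ContinuousLinearMap.adjoint (linSymb κ b a u₀ y) = linSymb κ b a u₀ y ∧ ∀ ξ : E', ξ ≠ 0 → 0 < ⟪linSymb κ b a u₀ y ξ, ξ⟫ := by
  have hmem := jetBack_mem (κ := κ) hy (hg y hy) (baseJet κ u₀ y).2
  obtain ⟨hsym, hpos⟩ := hstruct _ hmem.1 hmem.2
  exact ⟨adjoint_symbOp κ b hsym, fun ξ hξ ↦ inner_symbOp_self_pos κ b hpos hξ⟩

end Literature.Analysis.PDE
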